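import Summits.AtomisticToContinuum.BoseEinsteinCondensation.Theses.BECInsertionCorrector
import Literature.MathematicalPhysics.QuantumManyBody.WeightedCorrector

/-!
# Negative lemmas for crux `CorrectorClosure` (stmt-AtomisticToContinuum-12058), VIII:
the single-mode lower bound for the Kipnis–Varadhan `H₋₁` norm — vacuity threshold `C ≥ 1/2` of
every `H₋₁` response bound (lines `healing-scale-kac-insertion` Stubs 4/6, K1 in `H₋₁` currency)

Supports stmt-AtomisticToContinuum-12058 (route `BECInsertionCorrector`). Line B of the crux
(`Cruxes/CorrectorClosure/Lines/healing-scale-kac-insertion.lean`, skeleton v3) consumes K1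
(`StaticResponseBound`) in `H₋₁` currency: `stub_responseDictionary` outputs, and the heart
`stub_kacClosure` assumes, `hMinusOneSqW L Θ₀ g_k ≤ ofReal (C N / max(ρ'a, |p|²))` for the density
modes `g_k = Σⱼ cos(p·xⱼ)`, `p = 2πk/L ≠ 0`, of the bath ground state `Θ₀`, the heart being stated
for EVERY `C > 0`. The lemmas below are the abstract core of the classical single-mode
(Bijl–Feynman / Cauchy–Schwarz) LOWER bound: testing Kipnis–Landim's variational formula
`‖g‖²₋₁ = sup_φ (2∫gφF² − 𝓔_F(φ,φ))` with `φ = t g`,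

  `‖g‖²₋₁ ≥ (∫ g² F²)² / 𝓔_F(g,g)`   (`𝓔_F(g,g) > 0`),   `‖g‖²₋₁ = ⊤` if `𝓔_F(g,g) = 0 ≠ ∫g²F²`.

Paper evaluation (translation-invariant normalised weight `Θ₀²`, the unique ground state):
`𝓔(g_k,g_k) = p² ∫Σⱼ sin²(p·xⱼ)Θ₀² = p²N/2` exactly, `∫g_k²Θ₀² = N S(k)/2` with the static structure
factor `S(k) = 1 + ρ'ĥ(p) → 1` as `|p| → ∞` (`h = g₂ − 1`, Riemann–Lebesgue); hence
`‖g_k‖²₋₁ ≥ N S(k)²/(2p²)` and an upper bound `≤ C N/max(ρ'a,p²)` forces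
`C ≥ S(k)² max(ρ'a,p²)/(2p²) ≥ S(k)²/2` for every `k ≠ 0`, i.e. `C ≥ 1/2` for EVERY admissible `v`:
`stub_kacClosure` is vacuously true for `C < 1/2` (only `C ≥ 1/2` carries content; it is consumed
with Stub 4's constant), Stub 4's `∃ C` is `≥ 1/2`, and K1's constant is `≥ 1/2` in `H₋₁` currency
(the energy-currency version is in the K1 disprover's file, `Cruxes/StaticResponseBound/Disproof.lean`
§C). Derivation and census: `Cruxes/CorrectorClosure/Disproof.lean` §16 (gen 4).
-/

noncomputable section

open MeasureTheory
open scoped ENNReal NNReal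

namespace Summit.AtomisticToContinuum.BoseEinsteinCondensation.Theorems.CorrectorClosure.Negative

open Literature.MathematicalPhysics.QuantumManyBody.BoseGas

variable {M : ℕ} {L : ℝ} {F g : Config M → ℝ}

/-- **Single-mode (Cauchy–Schwarz / Bijl–Feynman) lower bound for the `H₋₁` norm.** If `g` is a
periodic test function with `𝓔_F(g,g) > 0` then `(∫ g² F²)² / 𝓔_F(g,g) ≤ ‖g‖²₋₁` (test the
variational formula with `φ = (P/D) g`, `P = ∫g²F²`, `D = 𝓔_F(g,g)`). [folklore] -/
theorem ofReal_sq_div_dirichletFormW_le_hMinusOneSqW (hg : IsPeriodicTest L g)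
    (hD : 0 < dirichletFormW L F g g) :
    ENNReal.ofReal ((∫ X in cellN M L, g X * g X * F X ^ 2) ^ 2 / dirichletFormW L F g g) ≤
      hMinusOneSqW L F g := by
  set P : ℝ := ∫ X in cellN M L, g X * g X * F X ^ 2 with hP
  set D : ℝ := dirichletFormW L F g g with hDdef
  have h := le_hMinusOneSqW L F g (hg.smul (P / D))
  rw [integral_mul_smul_mul_sq, dirichletFormW_smul_left, dirichletFormW_smul_right] at h
  have hne : D ≠ 0 := hD.ne'
  have : 2 * (P / D * P) - P / D * (P / D * D) = P ^ 2 / D := by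
    field_simp
    ring
  rw [← hP, ← hDdef, this] at h
  exact h

/-- Degenerate case of the single-mode bound: `𝓔_F(g,g) = 0` with `∫ g² F² ≠ 0` forces
`‖g‖²₋₁ = ⊤` (test with `t g`, `|t| → ∞`). [folklore] -/
theorem hMinusOneSqW_eq_top_of_dirichletFormW_self_eq_zero (hg : IsPeriodicTest L g)
    (hD : dirichletFormW L F g g = 0) (hP : (∫ X in cellN M L, g X * g X * F X ^ 2) ≠ 0) :
    hMinusOneSqW L F g = ⊤ := by
  set P : ℝ := ∫ X in cellN M L, g X * g X * F X ^ 2 with hPdef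
  refine ENNReal.eq_top_of_forall_nnreal_le fun r => ?_
  have h := le_hMinusOneSqW L F g (hg.smul ((r : ℝ) / (2 * P)))
  rw [integral_mul_smul_mul_sq, dirichletFormW_smul_left, dirichletFormW_smul_right, ← hPdef, hD]
    at h
  have : 2 * ((r : ℝ) / (2 * P) * P) - (r : ℝ) / (2 * P) * ((r : ℝ) / (2 * P) * 0) = r := by
    field_simp
    ring
  rw [this, ENNReal.ofReal_coe_nnreal] at h
  exact h

/-- **Contrapositive packaging** against an `H₋₁` upper bound (the hypothesis of `stub_kacClosure`,
the output of `stub_responseDictionary`, K1 in `H₋₁` currency): `‖g‖²₋₁ ≤ ofReal B` forces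
`(∫ g² F²)² ≤ B·𝓔_F(g,g)` — with `g = g_k` and the evaluation in the module docstring,
`B ≥ N S(k)²/(2p²)`. [folklore] -/
theorem sq_integral_sq_le_of_hMinusOneSqW_le (hg : IsPeriodicTest L g) {B : ℝ} (hB : 0 ≤ B)
    (h : hMinusOneSqW L F g ≤ ENNReal.ofReal B) :
    (∫ X in cellN M L, g X * g X * F X ^ 2) ^ 2 ≤ B * dirichletFormW L F g g :=
  (hMinusOneSqW_le_ofReal_iff hB).1 h g hg

end Summit.AtomisticToContinuum.BoseEinsteinCondensation.Theorems.CorrectorClosure.Negative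

end
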